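import Mathlib.RingTheory.Localization.Integral
import Mathlib.RingTheory.Localization.Away.Basic
import Mathlib.RingTheory.Localization.Finiteness
import Mathlib.RingTheory.Localization.InvSubmonoid
import Mathlib.RingTheory.IntegralClosure.IsIntegralClosure.Basic
import Mathlib.RingTheory.Polynomial.ScaleRoots
import Mathlib.RingTheory.FiniteType
import HarnessLib

/-!
# Finiteness spreads out from a localization: `M⁻¹C` finite over `M⁻¹A` ⇒ `C[1/m]` finite over `A[1/m]`

Topic: `Literature/RingTheory/Localization` (EGA IV₃ 8.10.5 (x); The Stacks Project, Tag 01ZO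
"finite" in the list of properties of morphisms which descend through limits, here for the
cofiltered system of principal localizations `A[1/m]`, `m ∈ M`, with limit `M⁻¹A`).  Let `A → C`
be of finite type, `M ⊆ A` a submonoid, and suppose the localization `M⁻¹C` is integral (e.g.
module-finite) over `M⁻¹A`.  Then for a single `m ∈ M`, and then for every multiple of it, the
localization `C[1/m]` is module-finite over `A[1/m]`
(`exists_forall_finite_of_isIntegral_localization`).  Proof ("clearing denominators", as in
Atiyah–Macdonald, Prop. 5.12 / EGA IV₃ 8.10.5): each of the finitely many generators `c` of `C`
satisfies, after multiplication by some `m_c ∈ M`, a monic equation over `A` which holds in `C` up to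
an `M`-torsion factor `u_c` (Mathlib `IsIntegral.exists_multiple_integral_of_isLocalization` and
`IsLocalization.map_eq_zero_iff`); over `A[1/m]`, `m = ∏ m_c u_c`, the images of the generators are
therefore integral, and an algebra of finite type generated by integral elements is finite.

Everything is proved from Mathlib; no definitions, no named facts.

## References

* A. Grothendieck, J. Dieudonné, EGA IV₃, Publ. Math. IHÉS 28 (1966), Thm. 8.10.5 (x). [EGAIV3]
* The Stacks Project, Tag 01ZO. [StacksProject]
* M. F. Atiyah, I. G. Macdonald, *Introduction to Commutative Algebra* (1969), Prop. 5.12, Ch. 5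
  Ex. (integral dependence and localization).
-/

namespace Literature.RingTheory.Localization

universe u

open Polynomial

/-- **Clearing denominators in an integrality equation over a localization.** If the image of
`c ∈ C` in `M⁻¹C` is integral over `M⁻¹A`, there are `m, u ∈ M` and a monic `p ∈ A[X]` with
`u · p(m c) = 0` in `C`. [cite: EGAIV3, Thm. 8.10.5 (x) (proof)] -/
theorem exists_smul_aeval_smul_eq_zero {A C : Type*} [CommRing A] [CommRing C] [Algebra A C]
    (M : Submonoid A) {Aₘ Cₘ : Type*} [CommRing Aₘ] [CommRing Cₘ] [Algebra A Aₘ]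
    [IsLocalization M Aₘ] [Algebra C Cₘ] [IsLocalization (Algebra.algebraMapSubmonoid C M) Cₘ]
    [Algebra Aₘ Cₘ] [Algebra A Cₘ] [IsScalarTower A Aₘ Cₘ] [IsScalarTower A C Cₘ] (c : C)
    (hc : IsIntegral Aₘ (algebraMap C Cₘ c)) :
    ∃ m ∈ M, ∃ u ∈ M, ∃ p : A[X], p.Monic ∧ u • aeval (m • c) p = 0 := by
  obtain ⟨m, hm⟩ := IsIntegral.exists_multiple_integral_of_isLocalization M (Rₘ := Aₘ) _ hc
  obtain ⟨p, hp, hpx⟩ := hm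
  have h1 : m • algebraMap C Cₘ c = algebraMap C Cₘ ((m : A) • c) := by
    change (m : A) • algebraMap C Cₘ c = _
    rw [Algebra.smul_def, Algebra.smul_def, map_mul, ← IsScalarTower.algebraMap_apply]
  rw [h1, ← aeval_def, aeval_algebraMap_apply] at hpx
  obtain ⟨⟨u, hu⟩, hu0⟩ :=
    (IsLocalization.map_eq_zero_iff (Algebra.algebraMapSubmonoid C M) Cₘ _).mp hpx
  obtain ⟨u₀, hu₀, rfl⟩ := hu
  refine ⟨m, m.2, u₀, hu₀, p, hp, ?_⟩
  rw [Algebra.smul_def]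
  exact hu0

/-- **Finiteness spreads out from a localization** (EGA IV₃ 8.10.5 (x); Stacks 01ZO for the
system of principal localizations). Let `A → C` be of finite type and `M ⊆ A` a submonoid such
that `M⁻¹C` is integral over `M⁻¹A` (for instance module-finite). Then there is `m ∈ M` such that
for every multiple `m' ∈ M` of `m` and all localizations `A' = A[1/m']`, `C' = C[1/m']` (any models,
`IsLocalization.Away`, with compatible algebra structures), `C'` is module-finite over `A'`.
[cite: EGAIV3, Thm. 8.10.5 (x)] [cite: StacksProject, Tag 01ZO] -/
theorem exists_forall_finite_of_isIntegral_localization {A C : Type u} [CommRing A] [CommRing C]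
    [Algebra A C] [Algebra.FiniteType A C] (M : Submonoid A) {Aₘ Cₘ : Type*} [CommRing Aₘ]
    [CommRing Cₘ] [Algebra A Aₘ] [IsLocalization M Aₘ] [Algebra C Cₘ]
    [IsLocalization (Algebra.algebraMapSubmonoid C M) Cₘ] [Algebra Aₘ Cₘ] [Algebra A Cₘ]
    [IsScalarTower A Aₘ Cₘ] [IsScalarTower A C Cₘ] [Algebra.IsIntegral Aₘ Cₘ] :
    ∃ m ∈ M, ∀ m' ∈ M, m ∣ m' → ∀ (A' C' : Type u) [CommRing A'] [CommRing C'] [Algebra A A']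
      [Algebra C C'] [Algebra A' C'] [Algebra A C'] [IsScalarTower A A' C'] [IsScalarTower A C C']
      [IsLocalization.Away m' A'] [IsLocalization.Away (algebraMap A C m') C'],
      Module.Finite A' C' := by
  classical
  obtain ⟨t, ht⟩ := Algebra.FiniteType.out (R := A) (A := C)
  -- monic equations for the generators, with denominators `m_c` and torsion killers `u_c`
  choose mc hmc uc huc p hp hpu using fun c : C ↦
    exists_smul_aeval_smul_eq_zero M (Aₘ := Aₘ) (Cₘ := Cₘ) c (Algebra.IsIntegral.isIntegral _)
  refine ⟨∏ c ∈ t, (mc c * uc c), prod_mem fun c _ ↦ M.mul_mem (hmc c) (huc c), ?_⟩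
  intro m' hm' hdvd A' C' _ _ _ _ _ _ _ _ _ _
  -- `m'` is a unit in `A'`, hence so are all `m_c`, `u_c`, `c ∈ t`
  have hunit : IsUnit (algebraMap A A' m') := IsLocalization.Away.algebraMap_isUnit m'
  have hunit_mc : ∀ c ∈ t, IsUnit (algebraMap A A' (mc c)) := fun c hct ↦ by
    have h1 : mc c ∣ m' := (Dvd.intro _ rfl : mc c ∣ mc c * uc c).trans
      ((Finset.dvd_prod_of_mem (fun c ↦ mc c * uc c) hct).trans hdvd)
    obtain ⟨k, hk⟩ := h1
    rw [hk, map_mul] at hunit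
    exact isUnit_of_mul_isUnit_left hunit
  have hunit_uc : ∀ c ∈ t, IsUnit (algebraMap A A' (uc c)) := fun c hct ↦ by
    have h1 : uc c ∣ m' := (Dvd.intro_left _ rfl : uc c ∣ mc c * uc c).trans
      ((Finset.dvd_prod_of_mem (fun c ↦ mc c * uc c) hct).trans hdvd)
    obtain ⟨k, hk⟩ := h1
    rw [hk, map_mul] at hunit
    exact isUnit_of_mul_isUnit_left hunit
  -- the images of the generators in `C'` are integral over `A'`
  have hint : ∀ c ∈ t, IsIntegral A' (algebraMap C C' c) := by
    intro c hct
    -- `p(m_c c) = 0` in `C'` (the torsion killer `u_c` is a unit there)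
    have h0 : aeval (algebraMap C C' (mc c • c)) (p c) = 0 := by
      rw [aeval_algebraMap_apply]
      have h := congrArg (algebraMap C C') (hpu c)
      rw [map_zero, Algebra.smul_def, map_mul, ← IsScalarTower.algebraMap_apply,
        IsScalarTower.algebraMap_apply A A' C'] at h
      exact ((hunit_uc c hct).map (algebraMap A' C')).mul_right_eq_zero.mp h
    have h1 : IsIntegral A' (algebraMap C C' (mc c • c)) :=
      (IsIntegral.tower_top (A := A') ⟨p c, hp c, h0⟩)
    -- divide by the unit `m_c`
    obtain ⟨v, hv⟩ := hunit_mc c hct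
    have h2 : (↑v⁻¹ : A') • algebraMap C C' (mc c • c) = algebraMap C C' c := by
      rw [Algebra.smul_def (mc c) c, map_mul, ← IsScalarTower.algebraMap_apply A C C',
        IsScalarTower.algebraMap_apply A A' C', ← hv, Algebra.smul_def, ← mul_assoc, ← map_mul,
        Units.inv_mul, map_one, one_mul]
    rw [← h2]
    exact h1.smul _
  -- `C'` is generated over `A'` by the images of the generators
  have hgen : Algebra.adjoin A' ((algebraMap C C') '' (t : Set C)) = ⊤ := by
    rw [eq_top_iff]
    rintro x -
    obtain ⟨⟨c, ⟨_, ⟨k, rfl⟩⟩⟩, hx⟩ := IsLocalization.surj (Submonoid.powers (algebraMap A C m')) x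
    -- `x * (m')^k = c` in `C'`
    change x * algebraMap C C' (algebraMap A C m' ^ k) = algebraMap C C' c at hx
    obtain ⟨w, hw⟩ := hunit
    have hx' : x = algebraMap A' C' (↑(w⁻¹ ^ k) : A') * algebraMap C C' c := by
      rw [← hx, map_pow, ← IsScalarTower.algebraMap_apply, IsScalarTower.algebraMap_apply A A' C',
        ← hw, mul_comm x, ← mul_assoc, ← map_pow, ← map_mul, Units.val_pow_eq_pow_val,
        ← mul_pow, Units.inv_mul, one_pow, map_one, one_mul]
    rw [hx']
    refine Subalgebra.mul_mem _ (Subalgebra.algebraMap_mem _ _) ?_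
    -- `c ∈ A[t] = C`, so its image lies in `A'[image of t]`
    have hc : c ∈ Algebra.adjoin A (t : Set C) := by rw [ht]; trivial
    have hle : Algebra.adjoin A (t : Set C) ≤
        ((Algebra.adjoin A' ((algebraMap C C') '' (t : Set C))).restrictScalars A).comap
          (IsScalarTower.toAlgHom A C C') := by
      refine Algebra.adjoin_le fun y hy ↦ ?_
      rw [Subalgebra.coe_comap, Set.mem_preimage, Subalgebra.coe_restrictScalars, SetLike.mem_coe,
        IsScalarTower.toAlgHom_apply]
      exact Algebra.subset_adjoin ⟨y, hy, rfl⟩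
    have hc' := hle hc
    rw [Subalgebra.mem_comap, Subalgebra.mem_restrictScalars, IsScalarTower.toAlgHom_apply] at hc'
    exact hc'
  -- hence `C'` is integral and of finite type over `A'`, i.e. finite
  have hIC : Algebra.IsIntegral A' C' := by
    rw [← integralClosure_eq_top_iff, eq_top_iff, ← hgen]
    refine Algebra.adjoin_le ?_
    rintro _ ⟨c, hct, rfl⟩
    exact hint c hct
  haveI : Algebra.FiniteType C C' :=
    IsLocalization.finiteType_of_monoid_fg (Submonoid.powers (algebraMap A C m')) C'
  haveI : Algebra.FiniteType A C' := Algebra.FiniteType.trans (S := C) inferInstance inferInstance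
  haveI : Algebra.FiniteType A' C' := Algebra.FiniteType.of_restrictScalars_finiteType A A' C'
  exact Algebra.IsIntegral.finite

end Literature.RingTheory.Localization
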